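import Mathlib.RepresentationTheory.Homological.GroupCohomology.Functoriality
import Mathlib.GroupTheory.Index
import Mathlib.GroupTheory.GroupAction.Quotient
import Literature.AlgebraicGeometry.HodgeTheory.LocallyTrivialExtensionClasses

/-!
# Route LinearSystemTorelli — crux `LocalTubeSpan` (stmt-HodgeConjecture-2490): cyclic detection ascends from finite-index subgroups

Helper file (`--supports stmt-HodgeConjecture-2490`, line `Sketch` of the crux chain, cycle 4
"portability of cyclic detection", stub `stub_finiteIndexAscent`).  The line reduces the crux
("local Schnell theorem", C. Schnell, *Primitive cohomology and the tube mapping*, Math. Z. 268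
(2010) §3, §7) to CYCLIC DETECTION: injectivity of Schnell's third map
`evalCoinv A : H¹(G, A) → ∏_{g ∈ G} A/(g - 1)A` for the local monodromy representation.  This file
lets detection ASCEND from a subgroup of finite index invertible in the coefficient field (pure
local braid group inside the local braid group; the subgroup generated by powers of meridians):

* `localTubeSpan_H1res_injective_of_finiteIndex` — for a field `k`, a `k`-representation `A` of
  `G` and a subgroup `H ≤ G` of finite index with `[G : H] ≠ 0` in `k`, the restriction
  `H¹(G, A) → H¹(H, A)` is injective.
* `localTubeSpan_injective_evalCoinv_of_finiteIndex` — hence if Schnell's third map of `A|_H` is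
  injective, so is the third map of `A` (an undetected class of `G` restricts to an undetected
  class of `H`, since the value of the restricted class at `h ∈ H` is the value at `h`).

Proof of the first statement (averaging over cosets): a `1`-cocycle `φ` whose restriction to `H`
is the coboundary of `x` is replaced by `ψ = φ - d x`, which vanishes on `H` and is therefore
constant on the left cosets `gH` (cocycle identity).  With `y = ∑_{q ∈ G/H} ψ(q)` one gets
`g·y = ∑_q (ψ(g q) - ψ(g)) = y - [G : H] ψ(g)` (the sum is reindexed by the left action of `g` on
`G/H`), so `ψ = d(-[G : H]⁻¹ y)` is a coboundary, and so is `φ`.  Pure group cohomology over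
Mathlib (`groupCohomology.H1`, `cocycles₁`, `H1π_eq_zero_iff`, cosets `G ⧸ H`) and the tree's
vocabulary (`Literature.AlgebraicGeometry.HodgeTheory.LocallyTrivialExtensionClasses`: `H1res`,
`H1resKer_mk_iff`, `evalCoinv`, `evalCoinvOn`, `evalCoinv_H1π`, `evalCoinvOn_H1π`,
`mem_coboundaries₁_iff_exists`); no named facts, no geometry.
-/

-- `Summit.HodgeConjecture.HodgeConjecture.Theorems` is the mandated namespace (single-conjunct summit:
-- Sub = Summit), which `linter.dupNamespace` flags on every declaration; the lakefile turns the
-- linter off tree-wide (weak option), restated here so stand-alone elaboration is warning-free too.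
set_option linter.dupNamespace false

noncomputable section

open CategoryTheory groupCohomology
open Literature.AlgebraicGeometry.HodgeTheory

namespace Summit.HodgeConjecture.HodgeConjecture.Theorems

universe u

/-- **Averaging over cosets.** Let `H ≤ G` have finite index invertible in the field `k`, and let
`ψ : G → A` satisfy the `1`-cocycle identity and vanish on `H`.  Then `ψ` is a `1`-coboundary:
`ψ` is constant on the left cosets `gH`, and for `y = ∑_{q ∈ G/H} ψ(q)` one has
`g·y = y - [G : H] ψ(g)`, so `ψ(g) = g·z - z` with `z = -[G : H]⁻¹ y`. [folklore] -/
private theorem localTubeSpan_exists_sub_eq_of_vanish {k G : Type u} [Group G] [Field k]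
    (A : Rep k G) (H : Subgroup G) [H.FiniteIndex] (hn : (H.index : k) ≠ 0) (ψ : G → A.V)
    (hc : ∀ g h : G, ψ (g * h) = A.ρ g (ψ h) + ψ g) (hH : ∀ h ∈ H, ψ h = 0) :
    ∃ z : A.V, ∀ g : G, A.ρ g z - z = ψ g := by
  obtain ⟨_inst⟩ := nonempty_fintype (G ⧸ H)
  -- `ψ` is constant on left cosets of `H`
  have hconst : ∀ g h : G, h ∈ H → ψ (g * h) = ψ g := fun g h hh => by
    rw [hc, hH h hh, map_zero, zero_add]
  have hout : ∀ g : G, ψ ((g : G ⧸ H).out) = ψ g := fun g => by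
    obtain ⟨h, hh⟩ := QuotientGroup.mk_out_eq_mul H g
    rw [hh, hconst g h h.2]
  -- the average of the values of `ψ` over the cosets
  set y : A.V := ∑ q : G ⧸ H, ψ q.out with hy
  have hsum : ∀ g' : G, ∑ q : G ⧸ H, ψ (g' * q.out) = y := fun g' =>
    Fintype.sum_equiv (MulAction.toPerm g') _ _ fun q => by
      have e : ((g' * q.out : G) : G ⧸ H) = g' • q := MulAction.Quotient.coe_smul_out H g' q
      rw [MulAction.toPerm_apply, ← hout (g' * q.out), e]
  have hkey : ∀ g' : G, (H.index : k) • ψ g' = y - A.ρ g' y := fun g' => by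
    have h1 : A.ρ g' y = ∑ q : G ⧸ H, (ψ (g' * q.out) - ψ g') := by
      rw [hy, map_sum]
      refine Finset.sum_congr rfl fun q _ => ?_
      rw [hc g' q.out, add_sub_cancel_right]
    rw [h1, Finset.sum_sub_distrib, hsum g', Finset.sum_const, Finset.card_univ,
      ← Nat.cast_smul_eq_nsmul k, H.index_eq_card, Nat.card_eq_fintype_card, sub_sub_cancel]
  refine ⟨-((H.index : k)⁻¹ • y), fun g' => ?_⟩
  rw [map_neg, map_smul, neg_sub_neg, ← smul_sub, ← hkey g', inv_smul_smul₀ hn]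

/-- **Restriction to a finite-index subgroup is injective on `H¹`** when the index is invertible
in the coefficient field: for a field `k`, a `k`-linear representation `A` of `G` and `H ≤ G` of
finite index with `([G : H] : k) ≠ 0`, the restriction `res : H¹(G, A) → H¹(H, A|_H)` is
injective.  (A cocycle that is a coboundary `d x` on `H` becomes, after subtracting `d x`,
constant on the cosets `gH`, and is then the coboundary of `-[G : H]⁻¹ ∑_{q ∈ G/H} φ(q)`; the
shadow of `cor ∘ res = [G : H]`.) [folklore] -/
theorem localTubeSpan_H1res_injective_of_finiteIndex {k G : Type u} [Group G] [Field k]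
    (A : Rep k G) (H : Subgroup G) [H.FiniteIndex] (hn : (H.index : k) ≠ 0) :
    Function.Injective (H1res A H).hom := by
  refine (injective_iff_map_eq_zero _).2 fun ξ hξ => ?_
  induction ξ using H1_induction_on with
  | h φ =>
    have hmem : H1π A φ ∈ H1resKer A H := by
      rw [H1resKer, LinearMap.mem_ker]
      exact hξ
    obtain ⟨x, hx⟩ := (H1resKer_mk_iff H φ).1 hmem
    obtain ⟨z, hz⟩ := localTubeSpan_exists_sub_eq_of_vanish A H hn
      (fun g => φ g - (A.ρ g x - x))
      (fun g h => by
        simp only [(mem_cocycles₁_iff φ).1 φ.2 g h, map_sub, map_mul, Module.End.mul_apply]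
        abel)
      (fun h hh => by simp only [hx h hh, sub_self])
    rw [H1π_eq_zero_iff, mem_coboundaries₁_iff_exists]
    refine ⟨z + x, fun g => ?_⟩
    calc A.ρ g (z + x) - (z + x) = (A.ρ g z - z) + (A.ρ g x - x) := by rw [map_add]; abel
      _ = φ g := by rw [hz g, sub_add_cancel]

/-- **Cyclic detection ascends from finite-index subgroups.** For a field `k`, a `k`-linear
representation `A` of `G` and a subgroup `H ≤ G` of finite index with `([G : H] : k) ≠ 0`: if
Schnell's third map `H¹(H, A) → ∏_{h ∈ H} A/(h - 1)A` of `A|_H` is injective, then so is the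
third map `H¹(G, A) → ∏_{g ∈ G} A/(g - 1)A` of `A`.  Indeed a class undetected by every `g ∈ G`
restricts to a class of `H` undetected by every `h ∈ H` (same values), which vanishes by
hypothesis, and restriction is injective (`localTubeSpan_H1res_injective_of_finiteIndex`).  In the
route: detection for the local monodromy group follows from detection for a finite-index subgroup
(pure local braid group; subgroup generated by powers of the meridians).
[cite: Schnell2010, §7] -/
theorem localTubeSpan_injective_evalCoinv_of_finiteIndex {k G : Type u} [Group G] [Field k]
    (A : Rep k G) (H : Subgroup G) [H.FiniteIndex] (hn : (H.index : k) ≠ 0)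
    (hinj : Function.Injective (evalCoinv (Rep.res H.subtype A))) :
    Function.Injective (evalCoinv A) := by
  refine (injective_iff_map_eq_zero _).2 fun ξ hξ => ?_
  -- the restricted class is undetected by every `h ∈ H`
  have hOn : evalCoinvOn A H ξ = 0 := by
    induction ξ using H1_induction_on with
    | h φ =>
      funext g
      rw [evalCoinvOn_H1π, Pi.zero_apply, ← evalCoinv_H1π A φ (g : G), hξ, Pi.zero_apply]
  -- hence the restricted class vanishes ...
  have hres : (H1res A H).hom ξ = 0 := by
    refine hinj ?_
    rw [map_zero]
    exact hOn
  -- ... and so does the class itself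
  exact localTubeSpan_H1res_injective_of_finiteIndex A H hn (by rw [hres, map_zero])

end Summit.HodgeConjecture.HodgeConjecture.Theorems

end
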